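import Summits.BirchSwinnertonDyer.Rank1Residual.EisensteinPrimes
import Literature.NumberTheory.EllipticCurves.PointCountEulerCriterion
import HarnessLib

/-!
# Eisenstein primes of an elliptic curve over `ℚ`, II: the good ones are `{2, 3, 5, 7, 13, 37}`,
# the multiplicative ones `{2, 3, 5, 7, 13}`, the ANOMALOUS good ones `{3, 5, 7, 13}` —
# the prime support of the residual classes X1 and X2 in the kernel

HONEST FRAMING (cell `b2b-bsdres`, run/shared/lean/b2b/bsd-rank1-residual/, verbatim in every
file): the goal of the cell is to DELETE the COMBINATION-SHAPED residual classes of the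
Birch–Swinnerton-Dyer formula for ALL analytic-rank `≤ 1` elliptic curves over `ℚ` — "full BSD
formula for every rank `≤ 1` curve in class `C`" assembled STRICTLY from published theorems — so
that the rank-`≤ 1` remainder becomes exactly the CONSTRUCTION-SHAPED classes, which are TYPED
(missing-input `Prop`s), NOT attempted. This is not "finishing BSD". Sub-cell
`b2b-bsdres-eisenstein-p1` (CLASS-OWNERS.md row "X1 (r=0)"): research route; NO CLAIM BEYOND
STATED CLASSES; nothing here changes a label.

Theorems only (no definition, no named fact of our own). The residual classes X1 (`p > 2`, `E[p]`
reducible, good, anomalous `a_p ≡ 1 (mod p)`) and X2 (`p` odd, `E[p]` reducible, multiplicative)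
of RESIDUAL-CASES §a.2 are stated for every prime `p`; granted the two PUBLISHED named facts of
the tree `mazur_isogeny_irreducible` (Mazur 1978, Thm. 1: a rational `p`-isogeny forces
`p ∈ {2, 3, 5, 7, 11, 13, 17, 19, 37, 43, 67, 163}`) and `primeDegreeIsogeny_jTable` (the eleven
`j`-invariants of the rational isogenies of prime degree `ℓ ∈ {11, 17, 19, 37, 43, 67, 163}`:
Cremona, *Algorithms* §3.8 p. 82; Mazur 1978 table p. 129; Ligozat 1975; Mazur–Swinnerton-Dyer
1974), they are supported on FOUR primes, decided here in the kernel with the tools of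
`EisensteinPrimes.lean`:

* §4 `card_X37a_37`, `card_X37b_37` — kernel point counts `#Ẽ(𝔽₃₇) = 30`, i.e. `a₃₇ = 8`, for
  the two `X₀(37)` models `[1,1,1,-8,6]` (`j = -7·11³`) and `[1,1,1,-208083,-36621194]`
  (`j = -7·137³·2083³`) of `RationalIsogenyFrobeniusCertificates19and37.lean`; by the
  anomaly-transport criterion every curve with one of these `j` and good reduction at `37` has
  `a₃₇ = ±8 ≢ 1 (mod 37)`: `not_anom_thirtySeven` — **no elliptic curve over `ℚ` is anomalous
  Eisenstein at `37`** (the good × reducible × anomalous cell of the partition is empty at `37`,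
  while good × reducible × non-anomalous is not: `1225h1`, covered row C6);
* §5 `not_good_of_mem_jTable` — none of the nine tabulated `j` with `ℓ ≠ 37` belongs to a curve
  with good reduction at `ℓ` (`ord_ℓ j ∈ {1, 2}` or `ord_ℓ (j − 1728) = 1`, kernel arithmetic);
  `not_mult_of_mem_jTable` — none of the eleven to a curve multiplicative at `ℓ` (`ord_ℓ j ≥ 0`);
* §6 HEADLINES: `mem_of_red_of_good` — `E[p]` reducible and good at `p` ⟹ `p ∈ {2,3,5,7,13,37}`;
  `mem_of_red_of_mult` — reducible and multiplicative ⟹ `p ∈ {2,3,5,7,13}`;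
  **`mem_of_classX1` : `ClassX1 W p → p ∈ {3, 5, 7, 13}`** (`eq_or_of_classX1`);
  **`mem_of_classX2` : `ClassX2 W p → p ∈ {3, 5, 7, 13}`** (for sub-cell `eisenstein-p2`).

So the COMBINATION-shaped class X1 (both ranks; the leaf X1 ∩ {r = 0} of this sub-cell included)
and the CONSTRUCTION-shaped class X2 each consist of FOUR prime-indexed statements, `p = 3, 5, 7,
13` (X1R0-GAPMAP.md §9.3: `φ = 1` — a rational `p`-torsion point in the isogeny class — only at
`3, 5, 7`; `φ ≠ 1` even with `φ(p) = 1` at `3, 5, 7, 13`). Greenberg, LNM 1716 (1999) p. 137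
prints the weaker remark "reducible `E[p]` with good ordinary or multiplicative reduction at `p`
forces `p ∈ {2, 3, 5, 7, 13, 37}`"; the exclusion of `37` for ANOMALOUS primes (`a₃₇ = ±8` on the
two `X₀(37)` classes `1225h`) is the new line. Conditional only on the two cited named facts
(hypotheses `hMaz`, `hT`, as for the tree's other consumers); no sorry; standard axioms.

References: B. Mazur, Invent. Math. 44 (1978) Thm. 1, Cor. 4.4, table p. 129 [Mazur1978];
J. E. Cremona, *Algorithms for Modular Elliptic Curves* (1997) §3.8 p. 82 [CremonaAlgorithms1997];
B. Mazur, P. Swinnerton-Dyer, Invent. Math. 25 (1974) §5 [MazurSwinnertonDyer1974]; R. Greenberg,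
LNM 1716 (1999) p. 137 [GreenbergLNM1716]; RESIDUAL-CASES.md §a.2 X1/X2; PARTITION.md §3 rows
8, 16–18; HOME/b2b-bsdres-eisenstein-p1/X1R0-GAPMAP.md §9.3, §10.
-/

set_option autoImplicit false

noncomputable section

open scoped Classical

open WeierstrassCurve Literature.NumberTheory.EllipticCurves
  Literature.NumberTheory.EllipticCurves.Rank1Residual

namespace Summit.BirchSwinnertonDyer.Rank1Residual.EisensteinPrimes

/-! ### §4. The two `X₀(37)` classes: `a₃₇ = 8`, so no curve is anomalous Eisenstein at `37` -/

/-- `#Ẽ(𝔽₃₇) = 30`, i.e. `a₃₇ = 8`, for `E = [1, 1, 1, -8, 6]` (`j = -9317 = -7·11³`, the first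
`X₀(37)` class `1225h`, `Δ = -6125`; model of `RationalIsogenyFrobeniusCertificates19and37.lean`).
Kernel-decided (`natCard_point_eq_one_add_card` + `card_sol_eq_sum_euler` + `decide`). [folklore] -/
theorem card_X37a_37 :
    Nat.card (((⟨1, 1, 1, -8, 6⟩ : WeierstrassCurve ℤ).map
      (Int.castRingHom (ZMod 37))).toAffine.Point) = 30 := by
  rw [@WeierstrassCurve.natCard_point_eq_one_add_card (ZMod 37) (@ZMod.instField 37 ⟨by norm_num⟩)
    _ _ _ (by decide +kernel), @card_sol_eq_sum_euler (ZMod 37) (@ZMod.instField 37 ⟨by norm_num⟩)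
    _ _ (by rw [ZMod.ringChar_zmod_n]; decide), ZMod.card]
  decide +kernel

/-- `#Ẽ(𝔽₃₇) = 30`, i.e. `a₃₇ = 8`, for `E = [1, 1, 1, -208083, -36621194]`
(`j = -162677523113838677 = -7·137³·2083³`, the second `X₀(37)` class, `Δ = -6125`; model of
`RationalIsogenyFrobeniusCertificates19and37.lean`). Kernel-decided. [folklore] -/
theorem card_X37b_37 :
    Nat.card (((⟨1, 1, 1, -208083, -36621194⟩ : WeierstrassCurve ℤ).map
      (Int.castRingHom (ZMod 37))).toAffine.Point) = 30 := by
  rw [@WeierstrassCurve.natCard_point_eq_one_add_card (ZMod 37) (@ZMod.instField 37 ⟨by norm_num⟩)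
    _ _ _ (by decide +kernel), @card_sol_eq_sum_euler (ZMod 37) (@ZMod.instField 37 ⟨by norm_num⟩)
    _ _ (by rw [ZMod.ringChar_zmod_n]; decide), ZMod.card]
  decide +kernel

/-- **No curve with `j = -7·11³` is anomalous at `37`**: every such globally minimal `W` with good
reduction at `37` has `a₃₇(W) = ±8 ≢ 1 (mod 37)` (criterion `not_dvd_frobeniusTrace_sub_one_of_j_eq`
on `[1, 1, 1, -8, 6]` with `card_X37a_37`). [cite: MazurSwinnertonDyer1974, §5 (the rational points of X₀(37))] -/
theorem not_dvd_frobeniusTrace_sub_one_of_j_eq_X37a {W : WeierstrassCurve ℚ} [W.IsElliptic]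
    [W.IsGloballyMinimal] [Fact (Nat.Prime 37)] (hj : W.j = -9317)
    (hgood : W.HasGoodReductionAtPrime 37) : ¬ ((37 : ℤ) ∣ W.frobeniusTrace 37 - 1) := by
  have hjE : W.j = (((⟨1, 1, 1, -8, 6⟩ : WeierstrassCurve ℤ)).c₄ : ℚ) ^ 3 /
      (((⟨1, 1, 1, -8, 6⟩ : WeierstrassCurve ℤ)).Δ : ℚ) := by
    rw [hj]
    norm_num [WeierstrassCurve.Δ, WeierstrassCurve.c₄, WeierstrassCurve.b₂, WeierstrassCurve.b₄,
      WeierstrassCurve.b₆, WeierstrassCurve.b₈]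
  exact not_dvd_frobeniusTrace_sub_one_of_j_eq (⟨1, 1, 1, -8, 6⟩ : WeierstrassCurve ℤ)
    (forall_not_pow_dvd_or_of_bound _ (B := 3) (by decide +kernel) (by decide +kernel)
      (by decide +kernel))
    (by decide +kernel) (by decide +kernel) (p := 37) (by norm_num) (by decide +kernel) (n := 30)
    card_X37a_37 (by decide) hjE hgood

/-- **No curve with `j = -7·137³·2083³` is anomalous at `37`**: `a₃₇(W) = ±8 ≢ 1 (mod 37)`
(criterion on `[1, 1, 1, -208083, -36621194]` with `card_X37b_37`).
[cite: MazurSwinnertonDyer1974, §5 (the rational points of X₀(37))] -/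
theorem not_dvd_frobeniusTrace_sub_one_of_j_eq_X37b {W : WeierstrassCurve ℚ} [W.IsElliptic]
    [W.IsGloballyMinimal] [Fact (Nat.Prime 37)] (hj : W.j = -162677523113838677)
    (hgood : W.HasGoodReductionAtPrime 37) : ¬ ((37 : ℤ) ∣ W.frobeniusTrace 37 - 1) := by
  have hjE : W.j = (((⟨1, 1, 1, -208083, -36621194⟩ : WeierstrassCurve ℤ)).c₄ : ℚ) ^ 3 /
      (((⟨1, 1, 1, -208083, -36621194⟩ : WeierstrassCurve ℤ)).Δ : ℚ) := by
    rw [hj]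
    norm_num [WeierstrassCurve.Δ, WeierstrassCurve.c₄, WeierstrassCurve.b₂, WeierstrassCurve.b₄,
      WeierstrassCurve.b₆, WeierstrassCurve.b₈]
  exact not_dvd_frobeniusTrace_sub_one_of_j_eq
    (⟨1, 1, 1, -208083, -36621194⟩ : WeierstrassCurve ℤ)
    (forall_not_pow_dvd_or_of_bound _ (B := 3) (by decide +kernel) (by decide +kernel)
      (by decide +kernel))
    (by decide +kernel) (by decide +kernel) (p := 37) (by norm_num) (by decide +kernel) (n := 30)
    card_X37b_37 (by decide) hjE hgood

/-- **No elliptic curve over `ℚ` is anomalous Eisenstein at `p = 37`** (granted the `j`-table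
`primeDegreeIsogeny_jTable`): reducible `E[37]` puts `j(E)` on one of the two `X₀(37)` classes
(Mazur–Swinnerton-Dyer 1974), and there `a₃₇ = ±8`. So the good × reducible × anomalous cell of
the partition is EMPTY at `37` (while good × reducible × non-anomalous at `37` is not: `1225h1`).
[cite: MazurSwinnertonDyer1974, §5] [cite: CremonaAlgorithms1997, §3.8 p. 82] -/
theorem not_anom_thirtySeven (hT : primeDegreeIsogeny_jTable) (W : WeierstrassCurve ℚ)
    [W.IsElliptic] [W.IsGloballyMinimal] [Fact (Nat.Prime 37)] : ¬ Anom W 37 := by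
  rintro ⟨hred, hgood, hdvd⟩
  have hmem := mem_jTable_of_red hT W 37 (by decide) hred
  simp only [largePrimeIsogenyJTable, Finset.mem_insert, Finset.mem_singleton, Prod.mk.injEq]
    at hmem
  rcases hmem with ⟨h, -⟩ | ⟨h, -⟩ | ⟨h, -⟩ | ⟨h, -⟩ | ⟨h, -⟩ | ⟨h, -⟩ | ⟨-, hj⟩ | ⟨-, hj⟩ |
      ⟨h, -⟩ | ⟨h, -⟩ | ⟨h, -⟩
  all_goals first
    | exact absurd h (by norm_num)
    | exact not_dvd_frobeniusTrace_sub_one_of_j_eq_X37a hj hgood hdvd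
    | exact not_dvd_frobeniusTrace_sub_one_of_j_eq_X37b hj hgood hdvd

/-! ### §5. The nine tabulated `j` with `ℓ ≠ 37` are bad at `ℓ`; all eleven are not multiplicative -/

/-- **No tabulated `j` with `ℓ ≠ 37` belongs to a curve with good reduction at `ℓ`**:
`ord_ℓ j ∈ {1, 2}` (not a multiple of `3`) for `-11², -11·131³` at `11` and the two `j` at `17`;
`ord_ℓ (j − 1728) = 1` (odd) for `-2¹⁵` at `11`, `-96³` at `19` and the CM values at `43, 67, 163`
(`j − 1728 = -2⁶·7²·11`, `-2⁶·3⁶·19`, `-2⁶·3⁸·7²·43`, `-2⁶·3⁶·7²·31²·67`,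
`-2⁶·3⁶·7²·11²·19²·127²·163`). Kernel arithmetic against `padicValRat_j_eq_of_good` /
`padicValRat_j_sub_eq_of_good`. [cite: CremonaAlgorithms1997, §3.8 p. 82] -/
theorem not_good_of_mem_jTable {W : WeierstrassCurve ℚ} [W.IsElliptic] [W.IsGloballyMinimal]
    {p : ℕ} [Fact p.Prime] (hp37 : p ≠ 37) (hmem : (p, W.j) ∈ largePrimeIsogenyJTable) :
    ¬ Good W p := by
  intro hgood
  have h3 := three_dvd_padicValRat_j_of_good W p hgood
  have h2 := two_dvd_padicValRat_j_sub_of_good W p hgood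
  simp only [largePrimeIsogenyJTable, Finset.mem_insert, Finset.mem_singleton, Prod.mk.injEq]
    at hmem
  rcases hmem with ⟨rfl, hj⟩ | ⟨rfl, hj⟩ | ⟨rfl, hj⟩ | ⟨rfl, hj⟩ | ⟨rfl, hj⟩ | ⟨rfl, hj⟩ |
      ⟨rfl, -⟩ | ⟨rfl, -⟩ | ⟨rfl, hj⟩ | ⟨rfl, hj⟩ | ⟨rfl, hj⟩
  · -- (11, -2¹⁵): ord₁₁(j − 1728) = ord₁₁(−34496) = 1
    rw [hj, show ((-32768 : ℚ) - 1728) = ((-34496 : ℤ) : ℚ) by norm_num,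
      padicValRat_intCast_eq_of_dvd_of_not_dvd 11 (e := 1) (by decide) (by decide)] at h2
    omega
  · -- (11, -11²): ord₁₁ j = 2
    rw [hj, show (-121 : ℚ) = ((-121 : ℤ) : ℚ) by norm_num,
      padicValRat_intCast_eq_of_dvd_of_not_dvd 11 (e := 2) (by decide) (by decide)] at h3
    omega
  · -- (11, -11·131³): ord₁₁ j = 1
    rw [hj, show (-24729001 : ℚ) = ((-24729001 : ℤ) : ℚ) by norm_num,
      padicValRat_intCast_eq_of_dvd_of_not_dvd 11 (e := 1) (by decide) (by decide)] at h3
    omega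
  · -- (17, -17²·101³/2): ord₁₇ j = 2
    rw [hj, show ((-297756989 : ℚ) / 2) = ((-297756989 : ℤ) : ℚ) / ((2 : ℤ) : ℚ) by norm_num,
      padicValRat_intCast_div_eq_of_dvd_of_not_dvd 17 (e := 2) (by decide) (by decide) (by decide)
        (by decide)] at h3
    omega
  · -- (17, -17·373³/2¹⁷): ord₁₇ j = 1
    rw [hj, show ((-882216989 : ℚ) / 131072) = ((-882216989 : ℤ) : ℚ) / ((131072 : ℤ) : ℚ) by
        norm_num,
      padicValRat_intCast_div_eq_of_dvd_of_not_dvd 17 (e := 1) (by decide) (by decide) (by decide)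
        (by decide)] at h3
    omega
  · -- (19, -96³): ord₁₉(j − 1728) = ord₁₉(−886464) = 1
    rw [hj, show ((-884736 : ℚ) - 1728) = ((-886464 : ℤ) : ℚ) by norm_num,
      padicValRat_intCast_eq_of_dvd_of_not_dvd 19 (e := 1) (by decide) (by decide)] at h2
    omega
  · exact absurd rfl hp37
  · exact absurd rfl hp37
  · -- (43, -960³): ord₄₃(j − 1728) = 1
    rw [hj, show ((-884736000 : ℚ) - 1728) = ((-884737728 : ℤ) : ℚ) by norm_num,
      padicValRat_intCast_eq_of_dvd_of_not_dvd 43 (e := 1) (by decide) (by decide)] at h2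
    omega
  · -- (67, -5280³): ord₆₇(j − 1728) = 1
    rw [hj, show ((-147197952000 : ℚ) - 1728) = ((-147197953728 : ℤ) : ℚ) by norm_num,
      padicValRat_intCast_eq_of_dvd_of_not_dvd 67 (e := 1) (by decide) (by decide)] at h2
    omega
  · -- (163, -640320³): ord₁₆₃(j − 1728) = 1
    rw [hj, show ((-262537412640768000 : ℚ) - 1728) = ((-262537412640769728 : ℤ) : ℚ) by norm_num,
      padicValRat_intCast_eq_of_dvd_of_not_dvd 163 (e := 1) (by decide) (by decide)] at h2
    omega

/-- **No tabulated `j` belongs to a curve with multiplicative reduction at its `ℓ`**: all eleven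
have `ord_ℓ j ≥ 0` (`ord_ℓ j = 0, 2, 1` at `11`; `2, 1` at `17`; `0` at `19, 37, 43, 67, 163`),
against `padicValRat_j_neg_of_mult`. [cite: CremonaAlgorithms1997, §3.8 p. 82]
[cite: Mazur1978, Cor. 4.4 (p. 145): potentially good reduction at the odd primes] -/
theorem not_mult_of_mem_jTable {W : WeierstrassCurve ℚ} [W.IsElliptic] {p : ℕ} [Fact p.Prime]
    (hmem : (p, W.j) ∈ largePrimeIsogenyJTable) : ¬ Mult W p := by
  intro hmult
  have hneg := padicValRat_j_neg_of_mult W p hmult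
  simp only [largePrimeIsogenyJTable, Finset.mem_insert, Finset.mem_singleton, Prod.mk.injEq]
    at hmem
  rcases hmem with ⟨rfl, hj⟩ | ⟨rfl, hj⟩ | ⟨rfl, hj⟩ | ⟨rfl, hj⟩ | ⟨rfl, hj⟩ | ⟨rfl, hj⟩ |
      ⟨rfl, hj⟩ | ⟨rfl, hj⟩ | ⟨rfl, hj⟩ | ⟨rfl, hj⟩ | ⟨rfl, hj⟩
  · rw [hj, show (-32768 : ℚ) = ((-32768 : ℤ) : ℚ) by norm_num,
      padicValRat_intCast_eq_of_dvd_of_not_dvd 11 (e := 0) (by decide) (by decide)] at hneg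
    omega
  · rw [hj, show (-121 : ℚ) = ((-121 : ℤ) : ℚ) by norm_num,
      padicValRat_intCast_eq_of_dvd_of_not_dvd 11 (e := 2) (by decide) (by decide)] at hneg
    omega
  · rw [hj, show (-24729001 : ℚ) = ((-24729001 : ℤ) : ℚ) by norm_num,
      padicValRat_intCast_eq_of_dvd_of_not_dvd 11 (e := 1) (by decide) (by decide)] at hneg
    omega
  · rw [hj, show ((-297756989 : ℚ) / 2) = ((-297756989 : ℤ) : ℚ) / ((2 : ℤ) : ℚ) by norm_num,
      padicValRat_intCast_div_eq_of_dvd_of_not_dvd 17 (e := 2) (by decide) (by decide) (by decide)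
        (by decide)] at hneg
    omega
  · rw [hj, show ((-882216989 : ℚ) / 131072) = ((-882216989 : ℤ) : ℚ) / ((131072 : ℤ) : ℚ) by
        norm_num,
      padicValRat_intCast_div_eq_of_dvd_of_not_dvd 17 (e := 1) (by decide) (by decide) (by decide)
        (by decide)] at hneg
    omega
  · rw [hj, show (-884736 : ℚ) = ((-884736 : ℤ) : ℚ) by norm_num,
      padicValRat_intCast_eq_of_dvd_of_not_dvd 19 (e := 0) (by decide) (by decide)] at hneg
    omega
  · rw [hj, show (-9317 : ℚ) = ((-9317 : ℤ) : ℚ) by norm_num,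
      padicValRat_intCast_eq_of_dvd_of_not_dvd 37 (e := 0) (by decide) (by decide)] at hneg
    omega
  · rw [hj, show (-162677523113838677 : ℚ) = ((-162677523113838677 : ℤ) : ℚ) by norm_num,
      padicValRat_intCast_eq_of_dvd_of_not_dvd 37 (e := 0) (by decide) (by decide)] at hneg
    omega
  · rw [hj, show (-884736000 : ℚ) = ((-884736000 : ℤ) : ℚ) by norm_num,
      padicValRat_intCast_eq_of_dvd_of_not_dvd 43 (e := 0) (by decide) (by decide)] at hneg
    omega
  · rw [hj, show (-147197952000 : ℚ) = ((-147197952000 : ℤ) : ℚ) by norm_num,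
      padicValRat_intCast_eq_of_dvd_of_not_dvd 67 (e := 0) (by decide) (by decide)] at hneg
    omega
  · rw [hj, show (-262537412640768000 : ℚ) = ((-262537412640768000 : ℤ) : ℚ) by norm_num,
      padicValRat_intCast_eq_of_dvd_of_not_dvd 163 (e := 0) (by decide) (by decide)] at hneg
    omega

/-! ### §6. Headlines: the prime support of "Eisenstein", of X1 and of X2 -/

/-- **An Eisenstein prime of GOOD reduction is one of `2, 3, 5, 7, 13, 37`** (granted Mazur 1978
Thm. 1 and the `j`-table of the positive-genus levels): for an elliptic curve over `ℚ` with `E[p]`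
reducible and good reduction at `p`, `p ∈ {2, 3, 5, 7, 13, 37}`. (Greenberg, LNM 1716 p. 137,
records the same list for good ordinary or multiplicative reducible primes.) Both ends are sharp
(`X₀(p)` of genus `0` for `p ≤ 13`, `p ≠ 11`; `1225h1` at `37`).
[cite: Mazur1978, Thm. 1 and table p. 129] [cite: CremonaAlgorithms1997, §3.8 p. 82]
[cite: GreenbergLNM1716, p. 137] -/
theorem mem_of_red_of_good (hMaz : mazur_isogeny_irreducible) (hT : primeDegreeIsogeny_jTable)
    (W : WeierstrassCurve ℚ) [W.IsElliptic] [W.IsGloballyMinimal] (p : ℕ) [Fact p.Prime]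
    (hred : Red W p) (hgood : Good W p) : p ∈ ({2, 3, 5, 7, 13, 37} : Finset ℕ) := by
  have hM := mem_mazurPrimes_of_red hMaz W p hred
  simp only [mazurPrimes, Finset.mem_insert, Finset.mem_singleton] at hM
  simp only [Finset.mem_insert, Finset.mem_singleton]
  rcases hM with rfl | rfl | rfl | rfl | rfl | rfl | rfl | rfl | rfl | rfl | rfl | rfl
  all_goals first
    | decide
    | exact absurd hgood (not_good_of_mem_jTable (W := W) (by decide)
        (mem_jTable_of_red hT W _ (by decide) hred))

/-- **An Eisenstein prime of MULTIPLICATIVE reduction is one of `2, 3, 5, 7, 13`** (granted the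
same two facts): reducible `E[p]` and multiplicative reduction at `p` force `p ∈ {2, 3, 5, 7, 13}`
(the tabulated `j` are `p`-integral at their `p`; Mazur 1978 Cor. 4.4 gives potentially good
reduction at every odd prime for the positive-genus levels). For sub-cell `eisenstein-p2` (X2).
[cite: Mazur1978, Thm. 1, Cor. 4.4 and table p. 129] [cite: CremonaAlgorithms1997, §3.8 p. 82] -/
theorem mem_of_red_of_mult (hMaz : mazur_isogeny_irreducible) (hT : primeDegreeIsogeny_jTable)
    (W : WeierstrassCurve ℚ) [W.IsElliptic] (p : ℕ) [Fact p.Prime]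
    (hred : Red W p) (hmult : Mult W p) : p ∈ ({2, 3, 5, 7, 13} : Finset ℕ) := by
  have hM := mem_mazurPrimes_of_red hMaz W p hred
  simp only [mazurPrimes, Finset.mem_insert, Finset.mem_singleton] at hM
  simp only [Finset.mem_insert, Finset.mem_singleton]
  rcases hM with rfl | rfl | rfl | rfl | rfl | rfl | rfl | rfl | rfl | rfl | rfl | rfl
  all_goals first
    | decide
    | exact absurd hmult (not_mult_of_mem_jTable (W := W)
        (mem_jTable_of_red hT W _ (by decide) hred))

/-- **CLASS X1 LIVES AT `p ∈ {3, 5, 7, 13}`** (granted Mazur 1978 Thm. 1 and the `j`-table): an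
X1 pair (`p > 2`, `E[p]` reducible, good, anomalous — RESIDUAL-CASES §a.2 X1, both ranks; the
leaf X1 ∩ {r = 0} of sub-cell `eisenstein-p1` included) has `p = 3, 5, 7` or `13`: `p = 2` is
excluded by the class, `p = 37` by `not_anom_thirtySeven` (`a₃₇ = ±8` on the `X₀(37)` classes),
every other prime by `mem_of_red_of_good`. Research route; no claim about BSD is made here.
[cite: Mazur1978, Thm. 1 and table p. 129] [cite: MazurSwinnertonDyer1974, §5]
[cite: CremonaAlgorithms1997, §3.8 p. 82] -/
theorem mem_of_classX1 (hMaz : mazur_isogeny_irreducible) (hT : primeDegreeIsogeny_jTable)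
    (W : WeierstrassCurve ℚ) [W.IsElliptic] [W.IsGloballyMinimal] (p : ℕ) [Fact p.Prime]
    (hX1 : ClassX1 W p) : p ∈ ({3, 5, 7, 13} : Finset ℕ) := by
  obtain ⟨hp2, hred, hgood, hanom, -⟩ := hX1
  have hm := mem_of_red_of_good hMaz hT W p hred hgood
  simp only [Finset.mem_insert, Finset.mem_singleton] at hm ⊢
  rcases hm with rfl | rfl | rfl | rfl | rfl | rfl
  · exact absurd hp2 (by decide)
  · exact Or.inl rfl
  · exact Or.inr (Or.inl rfl)
  · exact Or.inr (Or.inr (Or.inl rfl))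
  · exact Or.inr (Or.inr (Or.inr rfl))
  · exact absurd hanom (not_anom_thirtySeven hT W)

/-- The same as a disjunction. [folklore] -/
theorem eq_or_of_classX1 (hMaz : mazur_isogeny_irreducible) (hT : primeDegreeIsogeny_jTable)
    (W : WeierstrassCurve ℚ) [W.IsElliptic] [W.IsGloballyMinimal] (p : ℕ) [Fact p.Prime]
    (hX1 : ClassX1 W p) : p = 3 ∨ p = 5 ∨ p = 7 ∨ p = 13 := by
  simpa only [Finset.mem_insert, Finset.mem_singleton] using mem_of_classX1 hMaz hT W p hX1

/-- **CLASS X2 LIVES AT `p ∈ {3, 5, 7, 13}`** (granted Mazur 1978 Thm. 1 and the `j`-table): an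
X2 pair (`p` odd, `E[p]` reducible, multiplicative at `p` — RESIDUAL-CASES §a.2 X2, both ranks) has
`p = 3, 5, 7` or `13`. For sub-cell `eisenstein-p2`. [cite: Mazur1978, Thm. 1, Cor. 4.4 and table p. 129]
[cite: CremonaAlgorithms1997, §3.8 p. 82] -/
theorem mem_of_classX2 (hMaz : mazur_isogeny_irreducible) (hT : primeDegreeIsogeny_jTable)
    (W : WeierstrassCurve ℚ) [W.IsElliptic] (p : ℕ) [Fact p.Prime] (hX2 : ClassX2 W p) :
    p ∈ ({3, 5, 7, 13} : Finset ℕ) := by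
  obtain ⟨hp2, hred, hmult⟩ := hX2
  have hm := mem_of_red_of_mult hMaz hT W p hred hmult
  simp only [Finset.mem_insert, Finset.mem_singleton] at hm ⊢
  rcases hm with rfl | rfl | rfl | rfl | rfl
  · exact absurd rfl hp2
  · exact Or.inl rfl
  · exact Or.inr (Or.inl rfl)
  · exact Or.inr (Or.inr (Or.inl rfl))
  · exact Or.inr (Or.inr (Or.inr rfl))

end Summit.BirchSwinnertonDyer.Rank1Residual.EisensteinPrimes

end
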